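import Literature.NumberTheory.EllipticCurves.CMNewformGamma0LevelDvdProofs
import Literature.NumberTheory.EllipticCurves.CMNewformGamma0BadEulerFactorsPadicCharacter
import HarnessLib

/-!
# The two-conjunct residual fact `Ribet1977_cmNewform_gamma0_level_and_badEulerFactor_padicCharacter` from its (BAD) conjunct alone

Topic `NumberTheory/EllipticCurves`; THEOREMS ONLY. The (LEVEL) conjunct `M ∣ |d_K|·N𝔪` is the theorem `IsNewform0.level_dvd_discr_mul_absNorm_of_embCoeff`
(`CMNewformGamma0LevelDvdProofs.lean`); hence the minimal residual fact `Ribet1977_cmNewform_gamma0_badEulerFactor_padicCharacter`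
(`CMNewformGamma0BadEulerFactorsPadicCharacter.lean`) implies the two-conjunct residual fact, and through
`ribet1977_cmNewform_gamma0_eulerFactor_padicCharacter_of_residual` the full Euler-factor fact. No new named fact.
References: [Ribet1977Nebentypus] §3 Cor. (3.5), Remark (3.5); [AtkinLehner1970] Thm. 4; [DiamondShurman2005] Thm. 6.5.4.
-/

noncomputable section

open scoped NumberField ModularForm MatrixGroups
open NumberField IsDedekindDomain CongruenceSubgroup
open Literature.NumberTheory.GaloisRepresentations Literature.NumberTheory.LFunctions Literature.NumberTheory.EllipticCurves

namespace Literature.NumberTheory.EllipticCurves.ModularForms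

/-- **The two-conjunct residual fact from its (BAD) conjunct**: `Ribet1977_cmNewform_gamma0_badEulerFactor_padicCharacter` implies
`Ribet1977_cmNewform_gamma0_level_and_badEulerFactor_padicCharacter`, the (LEVEL) conjunct being the theorem `IsNewform0.level_dvd_discr_mul_absNorm_of_embCoeff`.
[cite: Ribet1977Nebentypus, §3 Cor. (3.5) and Remark (3.5)] -/
theorem Ribet1977_cmNewform_gamma0_level_and_badEulerFactor_padicCharacter_of_bad (h : Ribet1977_cmNewform_gamma0_badEulerFactor_padicCharacter) :
    Ribet1977_cmNewform_gamma0_level_and_badEulerFactor_padicCharacter := by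
  intro K _ _ hK2 htc σ 𝔪 h𝔪 ψ hψ hψpow p _ e M _ g ι hng hcoeff S θ hθ
  exact ⟨IsNewform0.level_dvd_discr_mul_absNorm_of_embCoeff K hK2 htc σ 𝔪 h𝔪 ψ hψ hψpow e ι hng hcoeff,
    h K hK2 htc σ 𝔪 h𝔪 ψ hψ hψpow p e M g ι hng hcoeff S θ hθ⟩

/-- Hence the full sibling `Ribet1977_cmNewform_gamma0_eulerFactor_padicCharacter` (Euler factors at EVERY `ℓ ≠ p`) follows from the (BAD) conjunct alone.
[cite: Ribet1977Nebentypus, §3 Cor. (3.5) and Remark (3.5)] -/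
theorem ribet1977_cmNewform_gamma0_eulerFactor_padicCharacter_of_bad (h : Ribet1977_cmNewform_gamma0_badEulerFactor_padicCharacter) :
    Ribet1977_cmNewform_gamma0_eulerFactor_padicCharacter :=
  ribet1977_cmNewform_gamma0_eulerFactor_padicCharacter_of_residual (Ribet1977_cmNewform_gamma0_level_and_badEulerFactor_padicCharacter_of_bad h)

end Literature.NumberTheory.EllipticCurves.ModularForms

end
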